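import Literature.AnabelianGeometry.SemiGraphs.ArithOuterActionOfGraphAction
import HarnessLib

/-!
# [SemiAnbd] Prop 5.2 (iv) / Thm 5.4, producer row T54-B: stability of the tempered LEVELS under the
# arithmetic outer action (the binder `hK` of the arithmetic tree actions)

Mochizuki, *Semi-graphs of anabelioids*, Publ. RIMS **42** (2006), §0 p. 5 (outer semi-direct products
`G ⋊^out J`), §3 Rmk 3.1.2 p. 33 (the objects `Π/H` of `B^temp(Π)`), Prop 3.2 p. 35, Prop 3.6 (iv) p. 39,
§5 Def 5.1 (i) p. 62, Prop 5.2 (i)/(iv) pp. 63–64 ("every tempered covering of `𝒢` appears as the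
geometric component of a tempered covering of `𝔊`"), proof of Thm 5.4 p. 66 (the arithmetic tempered
group acts on the trees `𝒢_{∞,i}` of the Galois tower) [cite: MochizukiSemiAnbd2006, Prop 5.2 (iv), p. 64].

PROOF-ONLY file (no definitions, no named facts; seat abc-iut-L3-t9, the Galois-tower lineage; cell row
T54-B = `plan/GAP-LEDGER.md` G-w4d053-1, residual (E1) of abc-iut-L3-d4's tower third
`GaloisLevelData.arithTreeAct` (`ArithTreeTower.lean`), whose one non-structural binder is

  `hK : ∀ n e x, x ∈ ker ρ_n → Φ e x ∈ ker ρ_n`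

— the LEVELS `ker ρ_n ⊆ π₁^temp(𝒢)` of the Galois tower must be stable under the automorphism
components `Φ e` of the elements `e` of the arithmetic group `E = π₁^temp(𝒢) ⋊^out Π_A`
(abc-iut-w4-d082's `outerSemidirectProduct ρ`).  No `GaloisLevelData` can make `hK` hold for an ABSTRACT
outer action `ρ : Π_A → Out(π₁^temp 𝒢)`: `hK` at level `n` is EQUIVALENT to the `ρ(Π_A)`-invariance of the
normal subgroup `ker ρ_n`, a property of the pair (tower, action).  This file proves the reduction of
record:

* `outerSemidirectProduct.fst_apply_mem_of_reps` — `hK`-shape stability of a normal subgroup `K` under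
  ALL of `G ⋊^out J` follows from the existence, for each `j`, of ONE representative of `ρ j`
  mapping `K` into `K` (two representatives differ by an inner automorphism);
* `Subgroup.comap_eq_of_res_iso` / `map_eq_of_res_iso` — for a continuous endomorphism `φ` of a
  tempered group and a transitive object `X` of `B^temp(Π)` with a point of NORMAL stabiliser `N`, an
  isomorphism `B^temp(φ)(X) ≅ X` forces `φ⁻¹(N) = N` (and `Φ(N) = N` for a bi-continuous `Φ` agreeing with
  `φ`) — Rmk 3.1.2: the stabilisers of isomorphic transitive objects are conjugate;
* `ProfiniteSemiGraph.map_eq_of_chartPullback_iso` — hence, for a morphism `F : 𝒢 → 𝒢` of semi-graphs of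
  anabelioids and a bi-continuous `Φ` with `F^* ≅ B^temp(Φ)` through a chart `c` (the data produced by
  Prop 3.6 (iv) + Prop 3.2 in `ArithOuterActionOfGraphAction.exists_outerAction_of_graphAction`), every
  normal open `N` whose (transitive) object `X_N` is `F^*`-STABLE (`F^*(X_N) ≅ X_N`) satisfies `Φ(N) = N`;
  `…_of_btempPullback_iso` — the same with the stability hypothesis on a tempered COVERING `T` of `𝒢`
  charted to `X_N` (`F^*T ≅ T` in `B^temp(𝒢)`), which is the form Prop 5.2 (i) speaks about;
* `ProfiniteSemiGraph.levelStable_of_chartPullback_isos` — assembled: for the outer action `ρ` of a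
  pseudo-functorial graph action `F : Π_A → Hom 𝒢 𝒢` (the per-`a` representative data of
  `exists_outerAction_of_graphAction`) and any family of normal subgroups `K n` realised as point
  stabilisers of `F_a^*`-stable transitive objects, the binder `hK` HOLDS for `E = π₁^temp(𝒢) ⋊^out_ρ Π_A`
  with `Φ e :=` the automorphism component of `e`.

What remains producer debt after this file (stated, not hidden): an `F`-STABLE cofinal tower — levels
`𝒢_{∞,n}` with `F_a^*(𝒢_{∞,n}) ≅ 𝒢_{∞,n}` for all `a` — which is where the finiteness conditions of
Def 5.1 (i) enter print's proof of Prop 5.2 (i); and the dictionary "the chart image of `𝒢_{∞,n}` is the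
coset object of `ker ρ_n`" for abc-iut-L3-t9's chart (sequel).  Nothing here refers to the IUT corpus; no
side is taken on [IUTchIII] Cor 3.12; typed ≠ proved.
-/

namespace Literature.AnabelianGeometry.SemiGraphs

open CategoryTheory Literature.AnabelianGeometry.EtaleTheta

universe u w

/-! ### Outer semi-direct products: stability under all of `G ⋊^out J` from one representative per `j` -/

section OuterSemidirect

variable {G : Type*} [Group G] [TopologicalSpace G] {J : Type*} [Group J] (ρ : J →* TopOut G)

/-- **`hK` from representatives.**  If `K ⊴ G` is normal and every outer class `ρ j` has SOME
bi-continuous representative mapping `K` into `K`, then the automorphism component of EVERY element of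
`G ⋊^out_ρ J` maps `K` into `K` (two representatives of one outer class differ by an inner automorphism,
§0 p. 5, and `K` is normal). [cite: MochizukiSemiAnbd2006, §0 p.5] -/
theorem outerSemidirectProduct.fst_apply_mem_of_reps (K : Subgroup G) [K.Normal]
    (hrep : ∀ j : J, ∃ Φ : contMulAut G, TopOut.mk G Φ = ρ j ∧ ∀ x ∈ K, (Φ : MulAut G) x ∈ K)
    (p : outerSemidirectProduct ρ) {x : G} (hx : x ∈ K) :
    ((p : contMulAut G × J).1 : MulAut G) x ∈ K := by
  obtain ⟨Φ, hΦ, hΦK⟩ := hrep (p : contMulAut G × J).2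
  have hclass : TopOut.mk G Φ = TopOut.mk G (p : contMulAut G × J).1 := by rw [hΦ]; exact p.2.symm
  obtain ⟨g, hg⟩ := exists_conj_of_mk_eq Φ (p : contMulAut G × J).1 hclass
  rw [hg x]
  exact ‹K.Normal›.conj_mem _ (hΦK x hx) g

/-- Family form (the literal shape of the binder `hK` of `GaloisLevelData.arithTreeAct`, for the action
`e ↦` automorphism component of `e`): for a family of normal subgroups `K n`, per-`(n, j)` representatives
mapping `K n` into itself give `∀ n e x, x ∈ K n → (e.1.1) x ∈ K n`. [cite: MochizukiSemiAnbd2006, Thm 5.4, p. 66] -/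
theorem outerSemidirectProduct.levelStable_of_reps {ι : Type*} (K : ι → Subgroup G)
    (hKn : ∀ n, (K n).Normal)
    (hrep : ∀ (n : ι) (j : J), ∃ Φ : contMulAut G, TopOut.mk G Φ = ρ j ∧ ∀ x ∈ K n, (Φ : MulAut G) x ∈ K n)
    (n : ι) (e : outerSemidirectProduct ρ) (x : G) (hx : x ∈ K n) :
    ((e : contMulAut G × J).1 : MulAut G) x ∈ K n :=
  haveI := hKn n
  outerSemidirectProduct.fst_apply_mem_of_reps ρ (K n) (hrep n) e hx

end OuterSemidirect

/-! ### `B^temp(Π)`: an isomorphism `B^temp(φ)(X) ≅ X` pins `φ` on the (normal) stabilisers of `X` -/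

section BTempLemmas

variable {G : Type u} [Group G] [TopologicalSpace G]

/-- Pointwise equivariance of a morphism of `B^temp(Π)`. [folklore] -/
private theorem hom_ρ_apply {X Y : BTemp G} (f : X ⟶ Y) (g : G) (x : X.obj.V) :
    f.hom.hom (X.obj.ρ g x) = Y.obj.ρ g (f.hom.hom x) := by
  have e := ConcreteCategory.congr_hom (f.hom.comm g) x
  simpa only [types_comp_apply] using e

/-- `e.inv (e.hom x) = x` in `B^temp(Π)`. [folklore] -/
private theorem iso_inv_hom_apply {X Y : BTemp G} (e : X ≅ Y) (x : X.obj.V) :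
    e.inv.hom.hom (e.hom.hom.hom x) = x := by
  change (e.hom ≫ e.inv).hom.hom x = x
  rw [e.hom_inv_id]
  rfl

/-- **An isomorphism `B^temp(φ)(X) ≅ X` forces `φ⁻¹(N) = N`** for `X` transitive with a point `x` of
NORMAL stabiliser `N` ([SemiAnbd] Rmk 3.1.2: the point `x` of `B^temp(φ)(X)` has stabiliser `φ⁻¹(N)`, its
image in `X` has a stabiliser conjugate — hence equal — to `N`). [cite: MochizukiSemiAnbd2006, Rmk 3.1.2 p.33] -/
theorem Subgroup.comap_eq_of_res_iso (φ : G →ₜ* G) (X : BTemp G) (x : X.obj.V)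
    (htrans : ∀ y : X.obj.V, ∃ g : G, X.obj.ρ g x = y) (N : Subgroup G) [N.Normal]
    (hN : ∀ g : G, g ∈ N ↔ X.obj.ρ g x = x) (h : Nonempty ((BTemp.res φ).obj X ≅ X)) :
    N.comap φ.toMonoidHom = N := by
  obtain ⟨f⟩ := h
  letI : MulAction G X.obj.V := Action.instMulAction X.obj
  have hsmul : ∀ (g : G) (y : X.obj.V), X.obj.ρ g y = g • y := fun _ _ => rfl
  -- the image `y₀` of `x` and an element `h₀` carrying `x` to it
  set y₀ : X.obj.V := f.hom.hom.hom x with hy₀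
  obtain ⟨h₀, hh₀⟩ := htrans y₀
  -- equivariance of `f` read through `φ`
  have hf : ∀ g : G, f.hom.hom.hom (X.obj.ρ (φ g) x) = X.obj.ρ g y₀ := fun g =>
    hom_ρ_apply f.hom g x
  -- injectivity of `f` on points
  have hinj : Function.Injective (f.hom.hom.hom : X.obj.V → X.obj.V) := fun a b hab => by
    have := congrArg (f.inv.hom.hom) hab
    rwa [iso_inv_hom_apply, iso_inv_hom_apply] at this
  ext g
  rw [Subgroup.mem_comap]
  change φ g ∈ N ↔ g ∈ N
  rw [hN (φ g)]
  constructor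
  · intro hfix
    -- `g • y₀ = y₀`, i.e. `g` stabilises `h₀ • x`, so `h₀⁻¹ g h₀ ∈ N`, so `g ∈ N`
    have h1 : X.obj.ρ g y₀ = y₀ := by rw [← hf g, hfix]
    rw [← hh₀, hsmul, hsmul] at h1
    have h2 : (h₀⁻¹ * g * h₀) • x = x := by
      rw [mul_smul, mul_smul, h1, inv_smul_smul]
    have h3 : h₀⁻¹ * g * h₀ ∈ N := (hN _).mpr (by rw [hsmul]; exact h2)
    have h4 := ‹N.Normal›.conj_mem _ h3 h₀
    rwa [show h₀ * (h₀⁻¹ * g * h₀) * h₀⁻¹ = g by group] at h4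
  · intro hg
    -- `g ∈ N = Stab(y₀)` since `Stab(h₀ • x) = h₀ N h₀⁻¹ = N`
    have h3 : h₀⁻¹ * g * h₀ ∈ N := by
      have := ‹N.Normal›.conj_mem _ hg h₀⁻¹
      rwa [inv_inv] at this
    have h2 : (h₀⁻¹ * g * h₀) • x = x := by rw [← hsmul]; exact (hN _).mp h3
    have h1 : X.obj.ρ g y₀ = y₀ := by
      rw [← hh₀, hsmul, hsmul, ← mul_smul]
      conv_rhs => rw [← h2, ← mul_smul]
      congr 1
      group
    apply hinj
    rw [hf g, h1]

/-- Bi-continuous form: if moreover `Φ ∈ Aut_top(Π)` agrees with `φ` pointwise then `Φ(N) = N`.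
[cite: MochizukiSemiAnbd2006, Rmk 3.1.2 p.33] -/
theorem Subgroup.map_eq_of_res_iso (Φ : contMulAut G) (φ : G →ₜ* G) (hΦ : ∀ t, (Φ : MulAut G) t = φ t)
    (X : BTemp G) (x : X.obj.V) (htrans : ∀ y : X.obj.V, ∃ g : G, X.obj.ρ g x = y) (N : Subgroup G)
    [N.Normal] (hN : ∀ g : G, g ∈ N ↔ X.obj.ρ g x = x) (h : Nonempty ((BTemp.res φ).obj X ≅ X)) :
    N.map (Φ : MulAut G).toMonoidHom = N := by
  have hc := Subgroup.comap_eq_of_res_iso φ X x htrans N hN h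
  have key : ∀ g : G, (Φ : MulAut G) g ∈ N ↔ g ∈ N := fun g => by
    rw [hΦ g]
    have := Subgroup.ext_iff.mp hc g
    rwa [Subgroup.mem_comap] at this
  ext y
  simp only [Subgroup.mem_map, MulEquiv.coe_toMonoidHom]
  constructor
  · rintro ⟨g, hg, rfl⟩
    exact (key g).mpr hg
  · intro hy
    refine ⟨(Φ : MulAut G)⁻¹ y, (key _).mp ?_, ?_⟩
    · rwa [MulAut.apply_inv_self]
    · rw [MulAut.apply_inv_self]

variable [IsTopologicalGroup G]

/-- The coset object `Π/N` of an open normal `N` (Rmk 3.1.2) is transitive with base point of stabiliser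
`N`; hence `B^temp(φ)(Π/N) ≅ Π/N` forces `φ⁻¹(N) = N`. [cite: MochizukiSemiAnbd2006, Rmk 3.1.2 p.33] -/
theorem Subgroup.comap_eq_of_res_quotientObj_iso (hG : IsTempered G) (φ : G →ₜ* G) (N : Subgroup G)
    [N.Normal] (hN : IsOpen (N : Set G))
    (h : Nonempty ((BTemp.res φ).obj (BTemp.quotientObj G hG N hN) ≅ BTemp.quotientObj G hG N hN)) :
    N.comap φ.toMonoidHom = N := by
  refine Subgroup.comap_eq_of_res_iso φ (BTemp.quotientObj G hG N hN) ((1 : G) : G ⧸ N)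
    (fun y => ?_) N (fun g => ?_) h
  · obtain ⟨g, rfl⟩ := QuotientGroup.mk_surjective y
    refine ⟨g, ?_⟩
    change g • ((1 : G) : G ⧸ N) = (g : G ⧸ N)
    rw [MulAction.Quotient.smul_mk, smul_eq_mul, mul_one]
  · change g ∈ N ↔ g • ((1 : G) : G ⧸ N) = ((1 : G) : G ⧸ N)
    rw [MulAction.Quotient.smul_mk, smul_eq_mul, mul_one, eq_comm, QuotientGroup.eq, inv_one, one_mul]

end BTempLemmas

/-! ### Through a chart: `F^*`-stable levels are `Φ`-stable -/

namespace ProfiniteSemiGraph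

variable {𝒢 : ProfiniteSemiGraph.{u}} (c : TemperedPiChart 𝒢)

section OneHom

variable (F : Hom 𝒢 𝒢) (Φ : contMulAut c.G) (φ : c.G →ₜ* c.G) (hΦ : ∀ t, (Φ : MulAut c.G) t = φ t)
  (hiso : Nonempty (F.chartPullback c c ≅ BTemp.res φ))

include hΦ hiso in
/-- **A level whose object is `F^*`-stable is `Φ`-stable.**  For a morphism of semi-graphs of anabelioids
`F : 𝒢 → 𝒢` and a bi-continuous `Φ` with `F^* ≅ B^temp(Φ)` through the chart `c` (Prop 3.6 (iv) + Prop
3.2), every normal subgroup `N` realised as the stabiliser of a point of a transitive object `X` of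
`B^temp(π₁^temp 𝒢)` with `F^*(X) ≅ X` satisfies `Φ(N) = N`. [cite: MochizukiSemiAnbd2006, Prop 5.2 (iv), p. 64] -/
theorem map_eq_of_chartPullback_iso (X : BTemp c.G) (x : X.obj.V)
    (htrans : ∀ y : X.obj.V, ∃ g : c.G, X.obj.ρ g x = y) (N : Subgroup c.G) [N.Normal]
    (hN : ∀ g : c.G, g ∈ N ↔ X.obj.ρ g x = x) (hlev : Nonempty ((F.chartPullback c c).obj X ≅ X)) :
    N.map (Φ : MulAut c.G).toMonoidHom = N :=
  Subgroup.map_eq_of_res_iso Φ φ hΦ X x htrans N hN ⟨(hiso.some.app X).symm ≪≫ hlev.some⟩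

include hΦ hiso in
/-- Coset form: an `F^*`-stable coset object `Π/N` (`N` open normal) has `Φ(N) = N`.
[cite: MochizukiSemiAnbd2006, Prop 5.2 (iv), p. 64] -/
theorem map_eq_of_chartPullback_quotientObj_iso (N : Subgroup c.G) [N.Normal] (hN : IsOpen (N : Set c.G))
    (hlev : Nonempty ((F.chartPullback c c).obj (BTemp.quotientObj c.G c.isTempered N hN) ≅
      BTemp.quotientObj c.G c.isTempered N hN)) :
    N.map (Φ : MulAut c.G).toMonoidHom = N := by
  refine map_eq_of_chartPullback_iso c F Φ φ hΦ hiso (BTemp.quotientObj c.G c.isTempered N hN)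
    ((1 : c.G) : c.G ⧸ N) (fun y => ?_) N (fun g => ?_) hlev
  · obtain ⟨g, rfl⟩ := QuotientGroup.mk_surjective y
    refine ⟨g, ?_⟩
    change g • ((1 : c.G) : c.G ⧸ N) = (g : c.G ⧸ N)
    rw [MulAction.Quotient.smul_mk, smul_eq_mul, mul_one]
  · change g ∈ N ↔ g • ((1 : c.G) : c.G ⧸ N) = ((1 : c.G) : c.G ⧸ N)
    rw [MulAction.Quotient.smul_mk, smul_eq_mul, mul_one, eq_comm, QuotientGroup.eq, inv_one, one_mul]

/-- **Covering form** (the shape of Prop 5.2 (i)): if a tempered covering `T` of `𝒢` is `F^*`-STABLE —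
`F^*T ≅ T` in `B^temp(𝒢)` — then its chart image `c(T)` is `F^*`-stable through the chart
(`chartPullback = c⁻¹ ⋙ F^* ⋙ c`). [cite: MochizukiSemiAnbd2006, Prop 5.2 (i), p. 63] -/
theorem nonempty_chartPullback_obj_iso_of_btempPullback_iso (T : BTempCat 𝒢)
    (hT : Nonempty (F.btempPullback.obj T ≅ T)) {X : BTemp c.G} (e : c.equiv.functor.obj T ≅ X) :
    Nonempty ((F.chartPullback c c).obj X ≅ X) := by
  refine ⟨(F.chartPullback c c).mapIso e.symm ≪≫ ?_ ≪≫ e⟩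
  change c.equiv.functor.obj (F.btempPullback.obj (c.equiv.inverse.obj (c.equiv.functor.obj T))) ≅
    c.equiv.functor.obj T
  exact c.equiv.functor.mapIso (F.btempPullback.mapIso (c.equiv.unitIso.app T).symm ≪≫ hT.some)

include hΦ hiso in
/-- Covering form of the level stability: `F^*T ≅ T` for a tempered covering `T` charted to a transitive
object with a point of normal stabiliser `N` gives `Φ(N) = N`. [cite: MochizukiSemiAnbd2006, Prop 5.2 (iv), p. 64] -/
theorem map_eq_of_btempPullback_iso (T : BTempCat 𝒢) (hT : Nonempty (F.btempPullback.obj T ≅ T))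
    {X : BTemp c.G} (e : c.equiv.functor.obj T ≅ X) (x : X.obj.V)
    (htrans : ∀ y : X.obj.V, ∃ g : c.G, X.obj.ρ g x = y) (N : Subgroup c.G) [N.Normal]
    (hN : ∀ g : c.G, g ∈ N ↔ X.obj.ρ g x = x) :
    N.map (Φ : MulAut c.G).toMonoidHom = N :=
  map_eq_of_chartPullback_iso c F Φ φ hΦ hiso X x htrans N hN
    (nonempty_chartPullback_obj_iso_of_btempPullback_iso c F T hT e)

end OneHom

/-! ### Assembly: the binder `hK` for `π₁^temp(𝒢) ⋊^out_ρ Π_A` from `F^*`-stable levels -/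

section Assembly

variable {PA : Type w} [Group PA] (F : PA → Hom 𝒢 𝒢) (ρ : PA →* TopOut c.G)
  (hρ : ∀ a, ∃ (Φ : contMulAut c.G) (φ : c.G →ₜ* c.G),
    TopOut.mk c.G Φ = ρ a ∧ (∀ t, (Φ : MulAut c.G) t = φ t) ∧ Nonempty ((F a).chartPullback c c ≅ BTemp.res φ))

include hρ in
/-- **The binder `hK` of the arithmetic tree actions HOLDS for `F^*`-stable levels.**  Let `ρ` be the
outer action of a pseudo-functorial graph action `F : Π_A → Hom 𝒢 𝒢` with its per-`a` representative data
(`exists_outerAction_of_graphAction`).  If each level `K n ⊴ π₁^temp(𝒢)` is the stabiliser of a point of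
a transitive object `X n` of `B^temp(π₁^temp 𝒢)` which is `F_a^*`-stable for every `a`, then for EVERY
`e ∈ π₁^temp(𝒢) ⋊^out_ρ Π_A` the automorphism component of `e` maps `K n` into `K n` — the hypothesis
`hK` of `GaloisLevelData.arithTreeAct` (`ArithTreeTower.lean`) for `Φ e := e.1.1`.
[cite: MochizukiSemiAnbd2006, Thm 5.4, p. 66] -/
theorem levelStable_of_chartPullback_isos {ι : Type*} (K : ι → Subgroup c.G) (hKn : ∀ n, (K n).Normal)
    (X : ι → BTemp c.G) (x : ∀ n, (X n).obj.V)
    (htrans : ∀ (n : ι) (y : (X n).obj.V), ∃ g : c.G, (X n).obj.ρ g (x n) = y)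
    (hstab : ∀ (n : ι) (g : c.G), g ∈ K n ↔ (X n).obj.ρ g (x n) = x n)
    (hlev : ∀ (a : PA) (n : ι), Nonempty (((F a).chartPullback c c).obj (X n) ≅ X n))
    (n : ι) (e : outerSemidirectProduct ρ) (y : c.G) (hy : y ∈ K n) :
    ((e : contMulAut c.G × PA).1 : MulAut c.G) y ∈ K n := by
  refine outerSemidirectProduct.levelStable_of_reps ρ K hKn (fun m a => ?_) n e y hy
  obtain ⟨Φ, φ, hΦρ, hΦφ, hiso⟩ := hρ a
  haveI := hKn m
  have hmap := map_eq_of_chartPullback_iso c (F a) Φ φ hΦφ hiso (X m) (x m) (htrans m) (K m) (hstab m)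
    (hlev a m)
  refine ⟨Φ, hΦρ, fun z hz => ?_⟩
  rw [← hmap]
  exact ⟨z, hz, rfl⟩

include hρ in
/-- Coset-object form: if every coset object `π₁^temp(𝒢)/K n` (`K n` open normal) is `F_a^*`-stable then
`hK` holds. [cite: MochizukiSemiAnbd2006, Thm 5.4, p. 66] -/
theorem levelStable_of_chartPullback_quotientObj_isos {ι : Type*} (K : ι → Subgroup c.G)
    (hKn : ∀ n, (K n).Normal) (hKo : ∀ n, IsOpen (K n : Set c.G))
    (hlev : ∀ (a : PA) (n : ι), Nonempty (((F a).chartPullback c c).obj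
      (BTemp.quotientObj c.G c.isTempered (K n) (hKo n)) ≅ BTemp.quotientObj c.G c.isTempered (K n) (hKo n)))
    (n : ι) (e : outerSemidirectProduct ρ) (y : c.G) (hy : y ∈ K n) :
    ((e : contMulAut c.G × PA).1 : MulAut c.G) y ∈ K n := by
  refine outerSemidirectProduct.levelStable_of_reps ρ K hKn (fun m a => ?_) n e y hy
  obtain ⟨Φ, φ, hΦρ, hΦφ, hiso⟩ := hρ a
  haveI := hKn m
  have hmap := map_eq_of_chartPullback_quotientObj_iso c (F a) Φ φ hΦφ hiso (K m) (hKo m) (hlev a m)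
  refine ⟨Φ, hΦρ, fun z hz => ?_⟩
  rw [← hmap]
  exact ⟨z, hz, rfl⟩

include hρ in
/-- **Covering form** (Prop 5.2 (i) shape): if the levels `K n` are the stabilisers of points of the chart
images of tempered coverings `T n` of `𝒢` which are `F_a^*`-STABLE (`F_a^*(T n) ≅ T n` in `B^temp(𝒢)` for
all `a`), then `hK` holds for `π₁^temp(𝒢) ⋊^out_ρ Π_A`. [cite: MochizukiSemiAnbd2006, Prop 5.2 (i), p. 63] -/
theorem levelStable_of_btempPullback_isos {ι : Type*} (K : ι → Subgroup c.G) (hKn : ∀ n, (K n).Normal)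
    (T : ι → BTempCat 𝒢) (hT : ∀ (a : PA) (n : ι), Nonempty ((F a).btempPullback.obj (T n) ≅ T n))
    (X : ι → BTemp c.G) (e : ∀ n, c.equiv.functor.obj (T n) ≅ X n) (x : ∀ n, (X n).obj.V)
    (htrans : ∀ (n : ι) (y : (X n).obj.V), ∃ g : c.G, (X n).obj.ρ g (x n) = y)
    (hstab : ∀ (n : ι) (g : c.G), g ∈ K n ↔ (X n).obj.ρ g (x n) = x n)
    (n : ι) (e' : outerSemidirectProduct ρ) (y : c.G) (hy : y ∈ K n) :
    ((e' : contMulAut c.G × PA).1 : MulAut c.G) y ∈ K n :=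
  levelStable_of_chartPullback_isos c F ρ hρ K hKn X x htrans hstab
    (fun a m => nonempty_chartPullback_obj_iso_of_btempPullback_iso c (F a) (T m) (hT a m) (e m)) n e' y hy

/-- **From the graph action alone** (composite with `exists_outerAction_of_graphAction`): a
pseudo-functorial action `F` of `Π_A` on `𝒢` by morphisms of semi-graphs of anabelioids whose chart
pull-backs fix the objects `X n` carrying the levels yields an outer action `ρ` for which `hK` holds.
[cite: MochizukiSemiAnbd2006, Prop 5.2 (iv), p. 64] -/
theorem exists_outerAction_levelStable_of_graphAction
    (hmul : ∀ a b, Nonempty ((F (a * b)).chartPullback c c ≅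
      (F a).chartPullback c c ⋙ (F b).chartPullback c c))
    (hone : Nonempty ((F 1).chartPullback c c ≅ 𝟭 (BTemp c.G)))
    {ι : Type*} (K : ι → Subgroup c.G) (hKn : ∀ n, (K n).Normal)
    (X : ι → BTemp c.G) (x : ∀ n, (X n).obj.V)
    (htrans : ∀ (n : ι) (y : (X n).obj.V), ∃ g : c.G, (X n).obj.ρ g (x n) = y)
    (hstab : ∀ (n : ι) (g : c.G), g ∈ K n ↔ (X n).obj.ρ g (x n) = x n)
    (hlev : ∀ (a : PA) (n : ι), Nonempty (((F a).chartPullback c c).obj (X n) ≅ X n)) :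
    ∃ ρ : PA →* TopOut c.G,
      (∀ a, ∃ (Φ : contMulAut c.G) (φ : c.G →ₜ* c.G), TopOut.mk c.G Φ = ρ a ∧
        (∀ t, (Φ : MulAut c.G) t = φ t) ∧ Nonempty ((F a).chartPullback c c ≅ BTemp.res φ)) ∧
      ∀ (n : ι) (e : outerSemidirectProduct ρ) (y : c.G), y ∈ K n →
        ((e : contMulAut c.G × PA).1 : MulAut c.G) y ∈ K n := by
  obtain ⟨ρ, hρ⟩ := exists_outerAction_of_graphAction c F hmul hone
  exact ⟨ρ, hρ, levelStable_of_chartPullback_isos c F ρ hρ K hKn X x htrans hstab hlev⟩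

end Assembly

end ProfiniteSemiGraph

end Literature.AnabelianGeometry.SemiGraphs
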